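import Summits.BirchSwinnertonDyer.BirchSwinnertonDyer.Theorems.KolyvaginRankRigidityAtTwoChebotarevOneClassAtTwoAlgebra
import Summits.BirchSwinnertonDyer.BirchSwinnertonDyer.Theorems.GenusKolyvaginAtTwoEquivariantChebotarevAtTwoOffDiscField
import Literature.NumberTheory.EllipticCurves.HeegnerPointsKolyvaginPrimaryCebotarevFrobeniusProofs
import Literature.NumberTheory.EllipticCurves.HeegnerPointsKolyvaginPrimaryCongruenceProofs
import Literature.NumberTheory.EllipticCurves.IsogenyFrobeniusTraceProofs
import Literature.NumberTheory.EllipticCurves.HeegnerPointsOfConductor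
import Literature.NumberTheory.EllipticCurves.TorsionFrobeniusProofs
import HarnessLib

/-!
# Crux V2♭ `KolyvaginCorankLowerBoundAtTwo` (stmt-BirchSwinnertonDyer-24623), line `kolyvagin_depth_split`,
# stub T5⁺ (window supply), input T5b(a′): ČEBOTAREV AT `2` WITH PRESCRIBED MINIMUM LOCAL ORDER
# FOR ONE EIGENCLASS — both signs of `Δ_E`, both eigen-signs (helper, PROVED modulo the named fact
# `Automorphic.chebotarev_artinRep`; width seat `bsd-line-krr2-p2` g6)

McCallum 1991 Cor. 3.2 / Kolyvagin [LNM 1479, Prop. 8] AT `p = 2` for a SINGLE class: for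
`κ ∈ H¹(K, E[2^M])` with `c_* κ = ε κ` (`ε = ±1`) and `2^{m-1} κ ≠ 0`, above every bound there is a
Kolyvagin prime `ℓ` at `2` (`ℓ ∤ 2 N d_K`, `(ℓ)` inert, `Frob ℓ = Frob ∞` on `K(E[2^M])`, so
`2^M ∣ ℓ + 1`, `2^M ∣ a_ℓ`, i.e. `M ≤ M(ℓ)` in Zhang's notation) at whose place `λ` the classes
`2^j κ`, `j + 3 ≤ m`, are not locally trivial: **local order `≥ 2^{m-2}`**
(`exists_kolyvaginPrime_gt_two_eigenclass`, and the `Set.Infinite` form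
`setInfinite_kolyvaginPrime_two_eigenclass`).

Differences with the tree's `p = 2` theorem for `Δ_E < 0`
(`GenusExact.equivariantChebotarevAtTwo_of_not_isSquare`, τ-stable independent families with the
restriction-injectivity binder `hres`, exact orders): ONE class, NO `hres` (the inflated bit is
absorbed: Sah at `2`, `two_zsmul_eq_zero_of_h1Eval_eq_zero`), NO sign condition on `Δ_E` (the free
generator of `E[2^M]` over `ℤ/2^M[τ]` is replaced by the Weil-pairing bit
`exists_pow_smul_add_sign_conj_ne_zero`), either eigen-sign (the local value at `λ` is
`(1 + ε τ)[κ, ρ]`), at the price of two bits (`2^{m-2}` instead of `2^m`; one bit is genuinely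
lost when `Δ_E > 0`, where `τ = diag(1, -1)` on `T₂E`). Steps C–G (finite exceptional set,
Čebotarev in `c₀·res(ρ𝒩)`, inertness, local criterion at `λ`) are the tree's `p`-generic
`exists_kolyvaginPrime_gt_of_galoisElement`; `2^M ∣ a_ℓ` is read off above the bad primes of `E`.

This is input (a′) of the window step T5b of the lead's skeleton
(`Cruxes/KolyvaginCorankLowerBoundAtTwo/Lines/kolyvagin_depth_split.lean`, stub
`stub_windowSupplyAtStrongDepth`): there the class is `c_M(n)` (an `ε`-eigenclass by the landed T3
`stub_conjSign`) and the new window prime must avoid a finite set. The index produced here is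
`M ≤ M(ℓ)` (same level as the class); the margin `M + 1 ≤ M(ℓ)` that T1 needs is the subject of the
two-level sequel. HONEST FRAMING: helper (`--supports` 24623); conditional on the named fact
`Automorphic.chebotarev_artinRep` exactly like the tree's odd-`p` theorem; T5⁺ and V2♭ are NOT
proved here; BSD is not proved by any of this.

References: [McCallumLMS1991] §3 Prop. 3.1, Cor. 3.2; [GrossLMS1991] §9; [Kolyvagin1991MathAnn] §2
(Thm. 2.2, ref. [1] Prop. 8); [WZhang2014] Notations (xii); [TateGCFT1967] §2.4.
-/

set_option autoImplicit false
-- the Theorems namespace of this sub repeats the summit name by design (D-0017 nested layout)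
set_option linter.dupNamespace false

noncomputable section

open scoped Classical

namespace Summit.BirchSwinnertonDyer.BirchSwinnertonDyer.Theorems.KolyvaginLowerBoundAtTwo

open WeierstrassCurve Field
open Literature.NumberTheory.GaloisRepresentations Literature.NumberTheory.EllipticCurves

universe u

/-! ### The one-class Čebotarev theorem at `2` -/

section Main

open NumberField IsDedekindDomain Literature.NumberTheory

variable {W : WeierstrassCurve ℚ} {K : Type} [Field K] [NumberField K]

set_option maxHeartbeats 800000 in
/-- **Čebotarev at `2` for ONE eigenclass, both signs of `Δ_E`, loss ≤ 2 bits.** Let `E = W/ℚ`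
(globally minimal) have surjective `2`-adic tower, `K` imaginary quadratic with `c ≠ 1` in
`Aut(K/ℚ)` and `d_K·Δ_E ∉ ℚ^{×2}` (i.e. `ρ̄_{E,2}(Γ_K) = GL₂(𝔽₂)`; automatic on a Heegner field of
odd discriminant), `κ ∈ H¹(K, E[2^M])` with `c_* κ = ε κ` (`ε = ±1`) and `2^{m-1} κ ≠ 0`. Then for
every bound `b` there is a Kolyvagin prime `ℓ > b` at `2` (Zhang's sense, `M ≤ M(ℓ)`,
`Frob ℓ = Frob ∞` on `K(E[2^M])`) at whose place `λ` the classes `2^j κ`, `j + 3 ≤ m`, are NOT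
locally trivial (local order `≥ 2^{m-2}`). Proof: McCallum's Cor. 3.2 road with the three
`p = 2` inputs of `…ChebotarevOneClassAtTwoAlgebra` (Sah at `2`, dévissage, Weil-pairing bit) in
place of `±`-eigenvectors, and the tree's `p`-generic Steps C–G
(`exists_kolyvaginPrime_gt_of_galoisElement`); the local value at `λ` is `(1 + ε τ)[κ, ρ]`.
Conditional only on the named fact `Automorphic.chebotarev_artinRep` (as the tree's odd-`p`
theorem). [cite: McCallumLMS1991, §3 Prop. 3.1, Cor. 3.2] [cite: GrossLMS1991, §9]
[cite: Kolyvagin1991MathAnn, §2 (ref. [1] Prop. 8)] [cite: WZhang2014, Notations (xii)] -/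
theorem exists_kolyvaginPrime_gt_two_eigenclass (hC : Automorphic.chebotarev_artinRep) {N : ℕ}
    [NeZero N] [W.IsElliptic] [W.IsGloballyMinimal] (hK : IsImaginaryQuadratic K)
    (hns : ¬ IsSquare ((NumberField.discr K : ℚ) * W.Δ))
    (hρ : ∀ n : ℕ, W.HasSurjectiveModNGaloisRep (2 ^ n : ℕ)) {c : K ≃ₐ[ℚ] K} (hc : c ≠ 1)
    {M : ℕ} (hM : 1 ≤ M) (κ : galH1Torsion (W.baseChange K) ((2 ^ M : ℕ) : ℤ))
    {ε : ℤ} (hε : ε = 1 ∨ ε = -1) (hκ : conjAct W c ((2 ^ M : ℕ) : ℤ) κ = ε • κ)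
    {m : ℕ} (hm : (2 : ℤ) ^ (m - 1) • κ ≠ 0) (b : ℕ) :
    ∃ ℓ : ℕ, b < ℓ ∧ Zhang2014.IsKolyvaginPrime N W K 2 ℓ ∧ M ≤ Zhang2014.kolyvaginIndex W 2 ℓ ∧
      FrobEqFrobInfty W K (2 ^ M) ℓ ∧
      ∀ v : HeightOneSpectrum (𝓞 K), (ℓ : 𝓞 K) ∈ v.asIdeal → ∀ j : ℕ, j + 3 ≤ m →
        ((2 ^ j : ℕ) : ℤ) • κ ∉
          (W.baseChange K).torsionLocalKer (v.adicCompletion K) ((2 ^ M : ℕ) : ℤ) := by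
  classical
  have hp : Nat.Prime 2 := Nat.prime_two
  haveI : Fact (Nat.Prime 2) := ⟨hp⟩
  -- complex conjugation and its involutive lift to `K̄`
  obtain ⟨c₀, hc₀⟩ := exists_isComplexConjugation (Rat.castHom ℝ)
  have ht : IsLiftOfAut c (absGaloisTransport (K := ℚ) (L := K) c₀).toRingEquiv :=
    RatClosure.isLiftOfAut_absGaloisTransport_of_isImaginaryQuadratic hK hc hc₀
  have hinv : ∀ x, (absGaloisTransport (K := ℚ) (L := K) c₀).toRingEquiv
      ((absGaloisTransport (K := ℚ) (L := K) c₀).toRingEquiv x) = x := fun x ↦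
    RatClosure.absGaloisTransport_absGaloisTransport_of_sq_eq_one hc₀.sq_eq_one x
  -- ### Step B′: the Galois element `ρ`
  have hρex : ∃ ρ ∈ torsionFixing (W.baseChange K) ((2 ^ M : ℕ) : ℤ),
      ∀ g ∈ evalKer (W.baseChange K) ((2 ^ M : ℕ) : ℤ) (fun _ : Fin 1 ↦ κ),
      ∀ j : ℕ, j + 3 ≤ m → (2 : ℤ) ^ j • h1Eval (W.baseChange K) ((2 ^ M : ℕ) : ℤ) κ
        (ht.conjGalCMH (ρ * g) * (ρ * g)) ≠ 0 := by
    by_cases hm3 : m < 3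
    · exact ⟨1, Subgroup.one_mem _, fun g _ j hj ↦ absurd hj (by omega)⟩
    push Not at hm3
    -- (a) an element acting as `-1`, and Sah: some evaluation of `κ` has order `≥ 2^{m-1}`
    obtain ⟨z, hz⟩ := exists_smul_eq_neg_two_pow W hK.1 hM (hρ M)
    obtain ⟨g₀, hg₀, hg₀ne⟩ : ∃ g₀ ∈ torsionFixing (W.baseChange K) ((2 ^ M : ℕ) : ℤ),
        (2 : ℤ) ^ (m - 2) • h1Eval (W.baseChange K) ((2 ^ M : ℕ) : ℤ) κ g₀ ≠ 0 := by
      by_contra! hall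
      apply hm
      have h2 : (2 : ℤ) • ((2 : ℤ) ^ (m - 2) • κ) = 0 :=
        two_zsmul_eq_zero_of_h1Eval_eq_zero (W.baseChange K) _ hz fun g hg ↦ by
          rw [h1Eval_zsmul _ _ _ _ hg]; exact hall g hg
      rw [smul_smul, ← pow_succ'] at h2
      have e : m - 2 + 1 = m - 1 := by omega
      rwa [e] at h2
    -- (b) the image subgroup of `[κ, ·]` on `Γ_{K(E[2^M])}`: stable, hence `⊇ E[2^M][2^{m-1}]`
    set H : AddSubgroup (geomTorsion (W.baseChange K) ((2 ^ M : ℕ) : ℤ)) :=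
      { carrier := {t | ∃ g ∈ torsionFixing (W.baseChange K) ((2 ^ M : ℕ) : ℤ),
          h1Eval (W.baseChange K) ((2 ^ M : ℕ) : ℤ) κ g = t}
        add_mem' := by
          rintro _ _ ⟨g₁, hg₁, rfl⟩ ⟨g₂, hg₂, rfl⟩
          exact ⟨g₁ * g₂, mul_mem hg₁ hg₂, h1Eval_mul _ _ κ hg₁ g₂⟩
        zero_mem' := ⟨1, Subgroup.one_mem _, h1Eval_one _ _ κ⟩
        neg_mem' := by
          rintro _ ⟨g, hg, rfl⟩
          exact ⟨g⁻¹, inv_mem hg, h1Eval_inv _ _ κ hg⟩ } with hH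
    have hHstab : ∀ g : absoluteGaloisGroup K, ∀ t ∈ H, g • t ∈ H := by
      rintro g t ⟨g₁, hg₁, rfl⟩
      exact ⟨g * g₁ * g⁻¹, (torsionFixing_normal _ _).conj_mem _ hg₁ g, h1Eval_conj _ _ κ g hg₁⟩
    have hsurj2 : W.HasSurjectiveModNGaloisRep 2 := by simpa using hρ 1
    have hS := (GenusExact.image_two_of_not_isSquare W K hK.1 hsurj2 hns).1
    have hHbig : ∀ t : geomTorsion (W.baseChange K) ((2 ^ M : ℕ) : ℤ),
        (2 : ℤ) ^ (m - 1) • t = 0 → t ∈ H := by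
      intro t ht
      have e : m - 2 + 1 = m - 1 := by omega
      exact torsionBy_le_of_stable_of_pow_smul_ne_zero (W.baseChange K) M hS (m - 2) H hHstab
        ⟨_, ⟨g₀, hg₀, rfl⟩, hg₀ne⟩ t (by rw [e]; exact ht)
    -- (c) the Weil-pairing bit over `ℚ`: `x ∈ E[2^M]`, `2^{m-1} x = 0`, `2^{m-3}(x + ε c₀ x) ≠ 0`
    have hmM : m - 1 ≤ M := by
      by_contra hlt
      apply hm
      have hkill : ((2 : ℤ) ^ M) • κ = 0 := by
        have := zsmul_galH1Torsion_eq_zero _ _ κ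
        exact_mod_cast this
      have : (2 : ℤ) ^ (m - 1) • κ = (2 : ℤ) ^ (m - 1 - M) • ((2 : ℤ) ^ M • κ) := by
        rw [smul_smul, ← pow_add, Nat.sub_add_cancel (by omega)]
      rw [this, hkill, zsmul_zero]
    obtain ⟨x₀, hx₀⟩ := exists_pow_smul_add_sign_conj_ne_zero W hc₀ (m := m - 1) (by omega) hε
    have hdvd : ((2 ^ (m - 1) : ℕ) : ℤ) ∣ ((2 ^ M : ℕ) : ℤ) := by
      exact_mod_cast Nat.pow_dvd_pow 2 hmM
    set incl : geomTorsion W ((2 ^ (m - 1) : ℕ) : ℤ) →+ geomTorsion W ((2 ^ M : ℕ) : ℤ) :=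
      AddSubgroup.inclusion (W.geomTorsion_le_of_dvd hdvd) with hincl
    have hincl_inj : Function.Injective incl := AddSubgroup.inclusion_injective _
    have hincl_smul : ∀ y, incl (c₀ • y) = c₀ • incl y := fun _ ↦ rfl
    set x := incl x₀ with hx
    have hxkill : (2 : ℤ) ^ (m - 1) • x = 0 := by
      apply Subtype.ext
      rw [AddSubgroupClass.coe_zsmul, ZeroMemClass.coe_zero]
      change (2 : ℤ) ^ (m - 1) • (x₀ : geomPoints W) = 0
      have := (mem_geomTorsion_iff W _ (x₀ : geomPoints W)).mp x₀.2
      exact_mod_cast this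
    have hxne : (2 : ℤ) ^ (m - 3) • (x + ε • c₀ • x) ≠ 0 := by
      intro h0
      apply hx₀
      apply hincl_inj
      rw [map_nsmul, map_add, map_zsmul, hincl_smul, map_zero, ← hx,
        show m - 1 - 2 = m - 3 by omega, ← natCast_zsmul]
      exact_mod_cast h0
    -- (d) transport to `E(K̄)[2^M]`
    set θ := RatClosure.torsionEquiv (K := K) W ((2 ^ M : ℕ) : ℤ) with hθ
    have hθc : ∀ P, θ (c₀ • P) = ht.torsionMap W ((2 ^ M : ℕ) : ℤ) (θ P) := fun P ↦
      RatClosure.torsionEquiv_smul_of_lift W ht c₀ (fun _ ↦ rfl) _ P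
    have hx'kill : (2 : ℤ) ^ (m - 1) • θ x = 0 := by rw [← map_zsmul, hxkill, map_zero]
    have hx'ne : ∀ j : ℕ, j + 3 ≤ m →
        (2 : ℤ) ^ j • (ε • ht.torsionMap W ((2 ^ M : ℕ) : ℤ) (θ x) + θ x) ≠ 0 := by
      intro j hj h0
      apply hxne
      have h1 : (2 : ℤ) ^ j • (x + ε • c₀ • x) = 0 := by
        apply θ.injective
        rw [map_zsmul, map_add, map_zsmul, hθc, map_zero, add_comm]
        exact h0
      rw [show m - 3 = (m - 3 - j) + j by omega, pow_add, mul_smul, h1, smul_zero]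
    -- (e) `θ x = [κ, ρ]` for some `ρ`; then `[κ, (ρg)^τ (ρg)] = ε τ θx + θx` for `g ∈ 𝒩`
    obtain ⟨ρ, hρT, hρx⟩ : θ x ∈ H := hHbig _ hx'kill
    refine ⟨ρ, hρT, fun g hg j hj ↦ ?_⟩
    have hρg : ρ * g ∈ torsionFixing (W.baseChange K) ((2 ^ M : ℕ) : ℤ) := mul_mem hρT hg.1
    rw [h1Eval_mul _ _ κ (ht.conjGalCMH_mem_torsionFixing W hinv _ hρg),
      ht.h1Eval_conjGalCMH_of_eigen W hinv _ hε hκ hρg, h1Eval_mul _ _ κ hρT g, hg.2 0, add_zero,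
      hρx]
    exact hx'ne j hj
  obtain ⟨ρ, hρT, hρv⟩ := hρex
  -- ### Steps C–G (tree), above a bound that also clears the bad primes of `E`
  have hbad₀ : (W.badPlaces (𝓞 ℚ)).Finite := W.finite_badPlaces_holds (𝓞 ℚ)
  set B₀ : ℕ := hbad₀.toFinset.sup fun v ↦ (Rat.HeightOneSpectrum.primesEquiv v : ℕ) with hB₀
  obtain ⟨ℓ, hbℓ, hℓ, hℓN, hℓD, hℓ2, hprime, h32, g, hg, hloc⟩ :=
    exists_kolyvaginPrime_gt_of_galoisElement (W := W) (N := N) hC hK hp (M := M) hc₀ ht hinv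
      (fun _ : Fin 1 ↦ κ) hρT (max b B₀)
  have hbℓ' : b < ℓ := lt_of_le_of_lt (le_max_left _ _) hbℓ
  have hB₀ℓ : B₀ < ℓ := lt_of_le_of_lt (le_max_right _ _) hbℓ
  -- `M ≤ M(ℓ)`: `2^M ∣ ℓ + 1` and `2^M ∣ a_ℓ` (good reduction at `ℓ > B₀`)
  have hidx : M ≤ Zhang2014.kolyvaginIndex W 2 ℓ := by
    rw [Zhang2014.le_kolyvaginIndex_iff]
    refine ⟨pow_dvd_add_one_of_frobEqFrobInfty W (K := K) hp hM hℓ hℓ2 h32, ?_⟩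
    have h32' := h32
    obtain ⟨v₀, 𝔓₀, h, c₁, hℓv₀, -⟩ := h32'
    have hgood : W.HasGoodReductionAt v₀ := by
      by_contra hbad
      have hmem : v₀ ∈ hbad₀.toFinset := by
        rw [Set.Finite.mem_toFinset]; exact hbad
      have h1 : (Rat.HeightOneSpectrum.primesEquiv v₀ : ℕ) ≤ B₀ :=
        Finset.le_sup (f := fun v ↦ (Rat.HeightOneSpectrum.primesEquiv v : ℕ)) hmem
      rw [primesEquiv_eq_of_natCast_mem hℓ hℓv₀] at h1
      omega
    have h := pow_dvd_frobeniusTraceAt_of_frobEqFrobInfty W (K := K) hp hM hℓ hℓ2 h32 hℓv₀ hgood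
    rw [frobeniusTraceAt_eq_frobeniusTrace W v₀, primesEquiv_eq_of_natCast_mem hℓ hℓv₀] at h
    exact_mod_cast h
  have hkoly : Zhang2014.IsKolyvaginPrime N W K 2 ℓ :=
    ⟨hℓ, hℓN, hℓD, hℓ2, hprime, lt_of_lt_of_le (by omega) hidx⟩
  refine ⟨ℓ, hbℓ', hkoly, hidx, h32, fun v hv j hj hmem ↦ ?_⟩
  have hκcl : κ ∈ AddSubgroup.closure (Set.range fun _ : Fin 1 ↦ κ) :=
    AddSubgroup.subset_closure (Set.mem_range.mpr ⟨0, rfl⟩)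
  have hcl : ((2 ^ j : ℕ) : ℤ) • κ ∈ AddSubgroup.closure (Set.range fun _ : Fin 1 ↦ κ) :=
    AddSubgroup.zsmul_mem _ hκcl _
  have hρg : ρ * g ∈ torsionFixing (W.baseChange K) ((2 ^ M : ℕ) : ℤ) := mul_mem hρT hg.1
  have hF : ht.conjGalCMH (ρ * g) * (ρ * g) ∈ torsionFixing (W.baseChange K) ((2 ^ M : ℕ) : ℤ) :=
    mul_mem (ht.conjGalCMH_mem_torsionFixing W hinv _ hρg) hρg
  have h0 := (hloc _ hcl v hv).mp hmem
  rw [h1Eval_zsmul _ _ _ _ hF] at h0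
  exact hρv g hg j hj (by exact_mod_cast h0)


/-- **The `Set.Infinite` form** of `exists_kolyvaginPrime_gt_two_eigenclass` (so that a finite set
of primes — the current window of T5b — can be avoided): infinitely many Kolyvagin primes `ℓ` at
`2` with `M ≤ M(ℓ)`, `Frob ℓ = Frob ∞` on `K(E[2^M])`, at whose place the classes `2^j κ`
(`j + 3 ≤ m`) are not locally trivial. [cite: McCallumLMS1991, §3 Cor. 3.2]
[cite: WZhang2014, Notations (xii)] -/
theorem setInfinite_kolyvaginPrime_two_eigenclass (hC : Automorphic.chebotarev_artinRep) {N : ℕ}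
    [NeZero N] [W.IsElliptic] [W.IsGloballyMinimal] (hK : IsImaginaryQuadratic K)
    (hns : ¬ IsSquare ((NumberField.discr K : ℚ) * W.Δ))
    (hρ : ∀ n : ℕ, W.HasSurjectiveModNGaloisRep (2 ^ n : ℕ)) {c : K ≃ₐ[ℚ] K} (hc : c ≠ 1)
    {M : ℕ} (hM : 1 ≤ M) (κ : galH1Torsion (W.baseChange K) ((2 ^ M : ℕ) : ℤ))
    {ε : ℤ} (hε : ε = 1 ∨ ε = -1) (hκ : conjAct W c ((2 ^ M : ℕ) : ℤ) κ = ε • κ)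
    {m : ℕ} (hm : (2 : ℤ) ^ (m - 1) • κ ≠ 0) :
    Set.Infinite {ℓ : ℕ | Zhang2014.IsKolyvaginPrime N W K 2 ℓ ∧ M ≤ Zhang2014.kolyvaginIndex W 2 ℓ ∧
      FrobEqFrobInfty W K (2 ^ M) ℓ ∧
      ∀ v : HeightOneSpectrum (𝓞 K), (ℓ : 𝓞 K) ∈ v.asIdeal → ∀ j : ℕ, j + 3 ≤ m →
        ((2 ^ j : ℕ) : ℤ) • κ ∉
          (W.baseChange K).torsionLocalKer (v.adicCompletion K) ((2 ^ M : ℕ) : ℤ)} := by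
  refine Set.infinite_of_forall_exists_gt fun b ↦ ?_
  obtain ⟨ℓ, hbℓ, hkoly, hidx, h32, hloc⟩ :=
    exists_kolyvaginPrime_gt_two_eigenclass (N := N) hC hK hns hρ hc hM κ hε hκ hm b
  exact ⟨ℓ, ⟨hkoly, hidx, h32, hloc⟩, hbℓ⟩

end Main

end Summit.BirchSwinnertonDyer.BirchSwinnertonDyer.Theorems.KolyvaginLowerBoundAtTwo

end
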